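import Literature.NumberTheory.EllipticCurves.GreenbergVatsal2000.CharacterInvariantsTwisted
import Literature.NumberTheory.EllipticCurves.GreenbergVatsal2000.CharacterPAdicLFunctionExistenceProofs
import HarnessLib

/-!
# Greenberg–Vatsal 2000, §3 pp. 41–42 at a twist: the twisted character facts IMPLY their `χ = 1`
# siblings, and `L_{Σ₀}(C ⊗ χ, T)`, `L_{Σ₀}(D ⊗ χ, T) ∈ Λ` EXIST for residual characters of any
# conductor (Kubota–Leopoldt–Iwasawa) — companion THEOREMS of `CharacterInvariantsTwisted.lean`

HONEST FRAMING (cell `bsd-eis`, seat `bsd-eis-x3`; home `run/shared/lean/pub/bsd-eis/`): theorems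
only, no named fact. §1: `characterLFunctionC_hasUnitContent_and_order_eq_card_of_ne_one` ⟹
`characterLFunctionC_hasUnitContent_and_order_eq_card` (`p ∣ m ⇒ φ ≠ 1`) and
`characterLFunctionD_hasUnitContent_and_order_eq_card_of_ne_teichmuller` ⟹
`characterLFunctionD_hasUnitContent_and_order_eq_card` (`p ∤ d ⇒ ψ ≠ ω`), so the twisted facts are
not weaker restatements. §2–§3: the interpolating elements exist in the generality of the twisted
facts — `exists_isCharacterLFunctionD_of_exists_ne` (`ψ` mod `d` of ANY conductor, `ψ ≠ ω`: the
regulariser `c` of Lang Ch. 4 §3 is any integer prime to `dp` with `ψ(c) ≢ c (mod p)`) and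
`exists_isCharacterLFunctionC_of_ne_one` (`φ ≠ 1` mod `m` of ANY conductor: `c ≡ u (mod m)` with
`φ(u) ≠ 1`, `c ≡ 1` modulo `p` and the primes of `Σ₀` not dividing `m`) — the proofs of
`exists_isCharacterLFunctionD` / `exists_isCharacterLFunctionC` verbatim after the choice of `c`
(`KubotaLeopoldtIwasawaFunctionProofs.exists_iwasawaFunction_of_bernoulliMeasure`).

References: [GreenbergVatsal2000] §3 pp. 41–42; [LangCyclotomic1990] Ch. 4 §3 Thm. 3.2.
-/

noncomputable section

open scoped Classical

open NumberField IsDedekindDomain Finset PowerSeries Literature.NumberTheory.EllipticCurves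

namespace Literature.NumberTheory.EllipticCurves.GreenbergVatsal2000

open CyclotomicZp PadicOneUnits

/-! ## §1. Each twisted fact implies its `χ = 1` sibling -/

section Siblings

/-- A primitive Dirichlet character of level `m` with `p ∣ m` is non-trivial (the trivial character
has conductor `1`). [folklore] -/
private theorem ne_one_of_isPrimitive_of_dvd {p : ℕ} [Fact p.Prime] {m : ℕ} [NeZero m]
    {φ : DirichletCharacter (ZMod p) m} (hφ : φ.IsPrimitive) (hpm : p ∣ m) : φ ≠ 1 := by
  intro h1
  have hcond : m = 1 := by
    have := hφ
    rw [DirichletCharacter.isPrimitive_def, h1, DirichletCharacter.conductor_one] at this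
    exact this.symm
  have hp1 : p ∣ 1 := hcond ▸ hpm
  exact (Fact.out : p.Prime).one_lt.ne' (Nat.dvd_one.mp hp1)

/-- For `p ∤ d` and `p ≠ 2`, some integer `c` prime to `dp` has `ψ(c) ≠ c (mod p)`: take
`c ≡ 1 (mod d)`, `c ≡ 2 (mod p)` (Chinese remainder theorem), so `ψ(c) = 1 ≠ 2`. This is GV p. 29's
"since `ψ = ωφ⁻¹`, we have `ψ ≠ ω`" for a `ψ` unramified at `p`. [folklore] -/
private theorem exists_coprime_apply_ne_cast_of_not_dvd {p : ℕ} [Fact p.Prime] (hp : p ≠ 2)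
    {d : ℕ} [NeZero d] (hpd : ¬ p ∣ d) (ψ : DirichletCharacter (ZMod p) d) :
    ∃ c : ℕ, c.Coprime (d * p) ∧ ψ (c : ZMod d) ≠ (c : ZMod p) := by
  have pp : p.Prime := Fact.out
  have hcop : d.Coprime p := ((Nat.Prime.coprime_iff_not_dvd pp).mpr hpd).symm
  obtain ⟨c, hc1, hc2⟩ := Nat.chineseRemainder hcop 1 2
  have hcd : c.Coprime d := by
    have h := hc1.gcd_eq; rwa [Nat.gcd_one_left] at h
  have hcp : c.Coprime p := by
    have h := hc2.gcd_eq
    show c.gcd p = 1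
    rw [h]
    exact (Nat.coprime_primes Nat.prime_two pp).mpr (Ne.symm hp)
  refine ⟨c, hcd.mul_right hcp, ?_⟩
  have hcd' : (c : ZMod d) = 1 := by
    have := (ZMod.natCast_eq_natCast_iff' c 1 d).mpr hc1
    rwa [Nat.cast_one] at this
  have hcp' : (c : ZMod p) = 2 := by
    have := (ZMod.natCast_eq_natCast_iff' c 2 p).mpr hc2
    rwa [Nat.cast_ofNat] at this
  rw [hcd', map_one, hcp']
  haveI : Fact (1 < p) := ⟨pp.one_lt⟩
  intro h12
  have h1 : (1 : ZMod p) = 0 := by linear_combination -h12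
  exact one_ne_zero h1

/-- **The twisted `C`-fact implies the `χ = 1` fact** `characterLFunctionC_hasUnitContent_and_order_eq_card`
(`p ∣ m ⇒ φ ≠ 1`). Bookkeeping. [cite: GreenbergVatsal2000, §3 pp. 41–42 with §2 p. 29 (Prop. (2.6))] -/
theorem characterLFunctionC_hasUnitContent_and_order_eq_card_of_twisted
    (h : characterLFunctionC_hasUnitContent_and_order_eq_card_of_ne_one) :
    characterLFunctionC_hasUnitContent_and_order_eq_card := by
  intro p _ κ m _ φ S₀ Φ _ _ _ _ hp hpm hφ heven hκ hS₀ hSm hcard hact g hg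
  exact h p κ m φ S₀ Φ hp hφ heven (ne_one_of_isPrimitive_of_dvd hφ hpm) hκ hS₀ hSm hcard hact g hg

/-- **The twisted `D`-fact implies the `χ = 1` fact** `characterLFunctionD_hasUnitContent_and_order_eq_card`
(`p ∤ d ⇒ ψ ≠ ω`). Bookkeeping. [cite: GreenbergVatsal2000, §3 p. 42 with §2 p. 29 (Prop. (2.8))] -/
theorem characterLFunctionD_hasUnitContent_and_order_eq_card_of_twisted
    (h : characterLFunctionD_hasUnitContent_and_order_eq_card_of_ne_teichmuller) :
    characterLFunctionD_hasUnitContent_and_order_eq_card := by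
  intro p _ κ d _ ψ S₀ Ψ _ _ _ _ hp hpd hψ hodd hκ hS₀ hSd hcard hact g hg
  exact h p κ d ψ S₀ Ψ hp hψ hodd (exists_coprime_apply_ne_cast_of_not_dvd hp hpd ψ) hκ hS₀
    (fun ℓ hℓ hℓd _ ↦ hSd ℓ hℓ hℓd) hcard hact g hg

end Siblings

variable (p : ℕ) [Fact p.Prime]

/-! ### Places `v ∤ p` -/

omit [Fact p.Prime] in
/-- The cell's spelling of "`v ∤ p`" (`(p : 𝓞 ℚ) ∉ v`) implies `ℓ_v ≠ p`. [folklore] -/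
private theorem natGenerator_ne_of_natCast_not_mem {v : HeightOneSpectrum (𝓞 ℚ)}
    (h : ((p : ℕ) : 𝓞 ℚ) ∉ v.asIdeal) : Rat.HeightOneSpectrum.natGenerator v ≠ p := by
  intro hgen
  apply h
  have hdvd : Rat.HeightOneSpectrum.natGenerator v ∣ p := hgen ▸ dvd_refl _
  rw [Rat.HeightOneSpectrum.natGenerator_dvd_iff] at hdvd
  obtain ⟨x, hx, hxe⟩ := (Ideal.mem_map_of_equiv _ _).mp hdvd
  have : x = (p : 𝓞 ℚ) := by
    apply (Rat.IsIntegralClosure.intEquiv (𝓞 ℚ)).injective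
    rw [hxe, map_natCast]
  rwa [this] at hx

/-! ## §2. Existence of `L_{Σ₀}(D ⊗ χ, T)` for `ψ ≠ ω` of any conductor -/

section ExistenceD

variable {d : ℕ} (ψ : DirichletCharacter (ZMod p) d)

/-- `θ_k` on an integer prime to `p` (definitional unfolding). [folklore] -/
private theorem oddCharacterTwist_of_not_dvd (k : ℕ) {a : ℕ} (ha : ¬ p ∣ a) :
    oddCharacterTwist p ψ k a = teichmullerLift p (((a : ZMod p)⁻¹) ^ (k - 1) * (ψ (a : ZMod d))⁻¹) := by
  unfold oddCharacterTwist
  rw [if_neg ha]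

/-- **Choice of `c` for `D ⊗ χ`**: an integer `c` prime to `dp` with `ψ(c) ≢ c (mod p)` (i.e. a
witness of `ωψ⁻¹ ≠ 1`) is a regulariser: `1 − θ_1(c)c ≡ 1 − ψ(c)⁻¹c ≢ 0 (mod p)` (Lang Ch. 4 §3
"select `c` such that `χ(c) ≠ 1`", here `χ = ωψ⁻¹`). [cite: LangCyclotomic1990, Ch. 4 §3, definition of L_p (PDF p. 84)] -/
theorem isUnit_regulariser_D_of_apply_ne [NeZero d] {c : ℕ} (hc : c.Coprime (d * p))
    (hne : ψ (c : ZMod d) ≠ (c : ZMod p)) :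
    IsUnit (1 - oddCharacterTwist p ψ 1 c * c : ℤ_[p]) := by
  have pp : p.Prime := Fact.out
  have hcp : c.Coprime p := Nat.Coprime.coprime_dvd_right (dvd_mul_left p d) hc
  have hcd : c.Coprime d := Nat.Coprime.coprime_dvd_right (dvd_mul_right d p) hc
  have hpc : ¬ p ∣ c := fun h ↦ by
    have := Nat.dvd_gcd h (dvd_refl p)
    rw [hcp] at this
    exact pp.one_lt.ne' (Nat.dvd_one.mp this)
  have hc0 : (c : ZMod p) ≠ 0 := fun h ↦ hpc ((ZMod.natCast_eq_zero_iff c p).mp h)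
  have hψu : IsUnit (ψ (c : ZMod d)) :=
    IsUnit.map ψ ((ZMod.isUnit_iff_coprime c d).mpr hcd)
  have hψ0 : ψ (c : ZMod d) ≠ 0 := hψu.ne_zero
  apply isUnit_of_toZMod_ne_zero
  rw [map_sub, map_one, map_mul, map_natCast, oddCharacterTwist_of_not_dvd p ψ 1 hpc,
    toZMod_teichmullerLift, Nat.sub_self, pow_zero, one_mul]
  intro h0
  apply hne
  have h1 : (ψ (c : ZMod d))⁻¹ * (c : ZMod p) = 1 := by linear_combination -h0
  have h2 : ψ (c : ZMod d) * ((ψ (c : ZMod d))⁻¹ * (c : ZMod p)) = ψ (c : ZMod d) * 1 :=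
    congrArg (fun x ↦ ψ (c : ZMod d) * x) h1
  rw [← mul_assoc, mul_inv_cancel₀ hψ0, one_mul, mul_one] at h2
  exact h2.symm

/-- **Greenberg–Vatsal p. 42 at a twist / Kubota–Leopoldt–Iwasawa: `L_{Σ₀}(D ⊗ χ, T) ∈ Λ` exists for a
residual character `ψ ≠ ω` of ANY conductor** — for an odd prime `p`, a Dirichlet character `ψ` modulo
`d` (values in `𝔽_p`; `p ∣ d` allowed) with some `c` prime to `dp`, `ψ(c) ≢ c (mod p)`, and a finite
set `Σ₀` of places not above `p`, there is `g ∈ Λ` with `IsCharacterLFunctionD p ψ Σ₀ g`. The proof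
of `exists_isCharacterLFunctionD` verbatim with the regulariser of `isUnit_regulariser_D_of_apply_ne`.
[cite: GreenbergVatsal2000, §3 p. 42 (L(D,χ,T) ∈ Λ, its relation with L_p(ωχ⁻¹ψ⁻¹,s), Σ₀-depletion)]
[cite: LangCyclotomic1990, Ch. 4 §3, Thm. 3.2 (PDF p. 84)] -/
theorem exists_isCharacterLFunctionD_of_exists_ne [NeZero d] (S₀ : Finset (HeightOneSpectrum (𝓞 ℚ)))
    (hp : p ≠ 2) (hne : ∃ c : ℕ, c.Coprime (d * p) ∧ ψ (c : ZMod d) ≠ (c : ZMod p))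
    (hS : ∀ v ∈ S₀, ((p : ℕ) : 𝓞 ℚ) ∉ v.asIdeal) :
    ∃ g : IwasawaAlgebra p, IsCharacterLFunctionD p ψ S₀ g := by
  have pp : p.Prime := Fact.out
  obtain ⟨c, hc, hcne⟩ := hne
  have hunit := isUnit_regulariser_D_of_apply_ne p ψ hc hcne
  have hc' : c.Coprime (d * p * p) :=
    hc.mul_right (Nat.Coprime.coprime_dvd_right (dvd_mul_left p d) hc)
  haveI : NeZero (d * p) := ⟨mul_ne_zero (NeZero.ne d) pp.ne_zero⟩
  obtain ⟨_g, g', hg⟩ := exists_iwasawaFunction_of_bernoulliMeasure p hp hc'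
    (θ := oddCharacterTwist p ψ 1)
    (oddCharacterTwist_add_mul p ψ 1)
    (fun b hb ↦ oddCharacterTwist_eq_zero_of_dvd p ψ 1 hb) hunit
    (fun j ↦ oddCharacterTwist p ψ (j + 1))
    (fun j ↦ oddCharacterTwist_add_mul p ψ (j + 1))
    (fun j b hb ↦ oddCharacterTwist_eq_zero_of_dvd p ψ (j + 1) hb)
    (fun j ↦ oddCharacterTwist_mul p ψ (j + 1) c)
    (fun j b η hb ↦ oddCharacterTwist_twist p ψ hp j b η hb)
  -- Euler factors
  have hE : ∀ v : HeightOneSpectrum (𝓞 ℚ), ∃ e : PowerSeries ℤ_[p], v ∈ S₀ → ∀ j : ℕ,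
      HasSum (fun n ↦ ((PowerSeries.coeff n e : ℤ_[p]) : ℚ_[p]) *
          ((((cyclotomicGenerator p : ℕ) : ℚ_[p])⁻¹) ^ j - 1) ^ n)
        (1 - ((teichmullerLift p (ψ (Rat.HeightOneSpectrum.natGenerator v : ZMod d)) *
              teichmullerLift p (Rat.HeightOneSpectrum.natGenerator v : ZMod p) ^ j : ℤ_[p]) :
            ℚ_[p]) * ((Rat.HeightOneSpectrum.natGenerator v : ℚ_[p])⁻¹) ^ (j + 1)) := by
    intro v
    by_cases hv : v ∈ S₀
    · obtain ⟨e, he⟩ := exists_eulerFactorD p hp ψ (Rat.HeightOneSpectrum.prime_natGenerator v)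
        (natGenerator_ne_of_natCast_not_mem p (hS v hv))
      exact ⟨e, fun _ ↦ he⟩
    · exact ⟨1, fun h ↦ absurd h hv⟩
  choose e he using hE
  refine ⟨PowerSeries.C (2 : ℤ_[p]) * g' * ∏ v ∈ S₀, e v, fun k hk ↦ ?_⟩
  obtain ⟨j, rfl⟩ : ∃ j, k = j + 1 := ⟨k - 1, by omega⟩
  have hz : ‖(((cyclotomicGenerator p : ℕ) : ℚ_[p])⁻¹) ^ j - 1‖ < 1 :=
    norm_cyclotomicGenerator_inv_pow_sub_one_lt j
  have h2 := hasSum_intCoeff_C_mul_pow (2 : ℤ_[p]) ((((cyclotomicGenerator p : ℕ) : ℚ_[p])⁻¹) ^ j - 1)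
  have hg' := (hg j).2
  have hprod := hasSum_intCoeff_prod_mul_pow p S₀ e _ hz fun v hv ↦ he v hv j
  have h := hasSum_intCoeff_mul_mul_pow hz (hasSum_intCoeff_mul_mul_pow hz h2 hg') hprod
  simp only [Nat.add_sub_cancel]
  convert h using 1
  have h2c : ((2 : ℤ_[p]) : ℚ_[p]) = 2 := map_ofNat (PadicInt.Coe.ringHom (p := p)) 2
  unfold characterLValueD twistedBernoulli
  rw [Nat.add_sub_cancel, one_div, h2c]
  ring

end ExistenceD

/-! ## §3. Existence of `L_{Σ₀}(C ⊗ χ, T)` for `φ ≠ 1` of any conductor -/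

section ExistenceC

variable {m : ℕ} [NeZero m] (φ : DirichletCharacter (ZMod p) m)
  (S₀ : Finset (HeightOneSpectrum (𝓞 ℚ)))

omit [NeZero m] in
/-- `θ_k` on an integer prime to `pΣ₀` (definitional unfolding). [folklore] -/
private theorem depletedEvenCharacterTwist_of_not_dvd (k : ℕ) {c : ℕ} (hpc : ¬ p ∣ c)
    (hSc : ¬ ∃ v ∈ S₀, Rat.HeightOneSpectrum.natGenerator v ∣ c) :
    depletedEvenCharacterTwist p φ S₀ k c =
      teichmullerLift p (φ (c : ZMod m) * ((c : ZMod p)⁻¹) ^ k) := by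
  unfold depletedEvenCharacterTwist evenCharacterTwist
  rw [if_neg hSc, if_neg hpc]

/-- A non-trivial Dirichlet character takes a value `≠ 1` at some unit. [folklore] -/
private theorem exists_unit_apply_ne_one_of_ne_one (hφ1 : φ ≠ 1) : ∃ u : (ZMod m)ˣ, φ u ≠ 1 := by
  by_contra h
  push Not at h
  exact hφ1 (MulChar.ext fun u ↦ by rw [h u, MulChar.one_apply_coe])

/-- **Choice of `c` for `C ⊗ χ`** (Lang Ch. 4 §3: "If `χ` is non-trivial, we can select `c` such that
`χ(c) ≠ 1`"): for `φ ≠ 1` modulo `m` of ANY conductor there is an integer `c` prime to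
`N = m p ∏_{v∈Σ₀} ℓ_v` and to `p`, divisible by no `ℓ_v`, with `φ(c) ≠ 1` — Chinese remainder
theorem: `c ≡ u (mod m)`, `c ≡ 1` modulo the `ℓ_v ∤ m` and modulo `p` if `p ∤ m`.
[cite: LangCyclotomic1990, Ch. 4 §3, definition of L_p (PDF p. 84)] -/
theorem exists_regulariser_C_of_ne_one (hφ1 : φ ≠ 1) :
    ∃ c : ℕ, c.Coprime (depletedModulus p S₀ m * p) ∧ ¬ p ∣ c ∧
      (¬ ∃ v ∈ S₀, Rat.HeightOneSpectrum.natGenerator v ∣ c) ∧ φ (c : ZMod m) ≠ 1 := by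
  have pp : p.Prime := Fact.out
  obtain ⟨u, hu⟩ := exists_unit_apply_ne_one_of_ne_one p φ hφ1
  set M₂ : ℕ := (∏ v ∈ S₀.filter (fun v ↦ ¬ Rat.HeightOneSpectrum.natGenerator v ∣ m),
    Rat.HeightOneSpectrum.natGenerator v) * (if p ∣ m then 1 else p) with hM₂
  have hcop : m.Coprime M₂ := by
    refine Nat.Coprime.mul_right (Nat.Coprime.prod_right fun v hv ↦ ?_) ?_
    · have hv' := (Finset.mem_filter.mp hv).2
      exact ((Nat.Prime.coprime_iff_not_dvd (Rat.HeightOneSpectrum.prime_natGenerator v)).mpr hv').symm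
    · split_ifs with hpm
      · exact Nat.coprime_one_right m
      · exact ((Nat.Prime.coprime_iff_not_dvd pp).mpr hpm).symm
  obtain ⟨c, hc1, hc2⟩ := Nat.chineseRemainder hcop (u : ZMod m).val 1
  have hcu : (c : ZMod m) = (u : ZMod m) := by
    rw [← ZMod.natCast_zmod_val (u : ZMod m)]
    exact (ZMod.natCast_eq_natCast_iff' _ _ _).mpr hc1
  have hcm : c.Coprime m := (ZMod.isUnit_iff_coprime c m).mp (hcu ▸ u.isUnit)
  have hc1M : ∀ q : ℕ, q ∣ M₂ → c.Coprime q := fun q hq ↦ by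
    have h1 : c ≡ 1 [MOD q] := Nat.ModEq.of_dvd hq hc2
    have h2 := h1.gcd_eq
    rwa [Nat.gcd_one_left] at h2
  have hcp : c.Coprime p := by
    by_cases hpm : p ∣ m
    · exact Nat.Coprime.coprime_dvd_right hpm hcm
    · refine hc1M p ⟨∏ v ∈ S₀.filter (fun v ↦ ¬ Rat.HeightOneSpectrum.natGenerator v ∣ m),
        Rat.HeightOneSpectrum.natGenerator v, ?_⟩
      rw [hM₂, if_neg hpm, mul_comm]
  have hpc : ¬ p ∣ c := fun h ↦ by
    have := Nat.dvd_gcd h (dvd_refl p)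
    rw [hcp] at this
    exact pp.one_lt.ne' (Nat.dvd_one.mp this)
  have hcv : ∀ v ∈ S₀, c.Coprime (Rat.HeightOneSpectrum.natGenerator v) := by
    intro v hv
    by_cases hvm : Rat.HeightOneSpectrum.natGenerator v ∣ m
    · exact Nat.Coprime.coprime_dvd_right hvm hcm
    · refine hc1M _ (Dvd.dvd.mul_right ?_ _)
      exact Finset.dvd_prod_of_mem _ (Finset.mem_filter.mpr ⟨hv, hvm⟩)
  have hSc : ¬ ∃ v ∈ S₀, Rat.HeightOneSpectrum.natGenerator v ∣ c := by
    rintro ⟨v, hv, hdvd⟩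
    have h := Nat.dvd_gcd hdvd (dvd_refl (Rat.HeightOneSpectrum.natGenerator v))
    rw [hcv v hv] at h
    exact (Rat.HeightOneSpectrum.prime_natGenerator v).one_lt.ne' (Nat.dvd_one.mp h)
  refine ⟨c, ?_, hpc, hSc, by rwa [hcu]⟩
  unfold depletedModulus
  exact ((hcm.mul_right hcp).mul_right (Nat.Coprime.prod_right hcv)).mul_right hcp

/-- `N = m p ∏ ℓ_v ≠ 0`. [folklore] -/
private theorem depletedModulus_ne_zero' : depletedModulus p S₀ m ≠ 0 := by
  unfold depletedModulus
  exact mul_ne_zero (mul_ne_zero (NeZero.ne m) (Fact.out : p.Prime).ne_zero)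
    (Finset.prod_ne_zero_iff.mpr fun v _ ↦ (Rat.HeightOneSpectrum.prime_natGenerator v).ne_zero)

/-- **Greenberg–Vatsal p. 41 at a twist / Kubota–Leopoldt–Iwasawa: `L_{Σ₀}(C ⊗ χ, T) ∈ Λ` exists for
a residual character `φ ≠ 1` of ANY conductor** — for an odd prime `p`, a Dirichlet character
`φ ≠ 1` modulo `m` (values in `𝔽_p`; `p ∣ m` or not) and a finite set `Σ₀` of places, there is
`g ∈ Λ` with `IsCharacterLFunctionC p φ Σ₀ g`. The proof of `exists_isCharacterLFunctionC` verbatim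
with the regulariser of `exists_regulariser_C_of_ne_one`.
[cite: GreenbergVatsal2000, §3 p. 41 (L(C,χ,T) ∈ Λ and its relation with L_p(χωψ⁻¹,s))]
[cite: LangCyclotomic1990, Ch. 4 §3, Thm. 3.2 (PDF p. 84)] -/
theorem exists_isCharacterLFunctionC_of_ne_one (hp : p ≠ 2) (hφ1 : φ ≠ 1) :
    ∃ g : IwasawaAlgebra p, IsCharacterLFunctionC p φ S₀ g := by
  have pp : p.Prime := Fact.out
  obtain ⟨c, hcN, hpc, hSc, hφc⟩ := exists_regulariser_C_of_ne_one p φ S₀ hφ1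
  haveI : NeZero (depletedModulus p S₀ m) := ⟨depletedModulus_ne_zero' p S₀⟩
  have hc0 : (c : ZMod p) ≠ 0 := fun h ↦ hpc ((ZMod.natCast_eq_zero_iff c p).mp h)
  have hunit : IsUnit (1 - depletedEvenCharacterTwist p φ S₀ 1 c * c : ℤ_[p]) := by
    apply isUnit_of_toZMod_ne_zero
    rw [map_sub, map_one, map_mul, map_natCast, depletedEvenCharacterTwist_of_not_dvd p φ S₀ 1 hpc hSc,
      toZMod_teichmullerLift, pow_one, mul_assoc, inv_mul_cancel₀ hc0, mul_one, sub_ne_zero]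
    exact Ne.symm hφc
  obtain ⟨g, _g', hg⟩ := exists_iwasawaFunction_of_bernoulliMeasure p hp hcN
    (θ := depletedEvenCharacterTwist p φ S₀ 1)
    (depletedEvenCharacterTwist_add_depletedModulus p φ S₀ 1)
    (fun b hb ↦ depletedEvenCharacterTwist_eq_zero_of_dvd p φ S₀ 1 hb) hunit
    (fun j ↦ depletedEvenCharacterTwist p φ S₀ (j + 1))
    (fun j ↦ depletedEvenCharacterTwist_add_depletedModulus p φ S₀ (j + 1))
    (fun j b hb ↦ depletedEvenCharacterTwist_eq_zero_of_dvd p φ S₀ (j + 1) hb)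
    (fun j ↦ depletedEvenCharacterTwist_mul p φ S₀ (j + 1) c)
    (fun j b η hb ↦ depletedEvenCharacterTwist_twist p φ S₀ hp j b η hb)
  refine ⟨g, fun k hk ↦ ?_⟩
  obtain ⟨j, rfl⟩ : ∃ j, k = j + 1 := ⟨k - 1, by omega⟩
  have h := (hg j).1
  simp only [Nat.add_sub_cancel]
  convert h using 1
  unfold characterLValueC twistedBernoulli
  rw [Nat.add_sub_cancel, one_div, neg_mul]

end ExistenceC

end Literature.NumberTheory.EllipticCurves.GreenbergVatsal2000

end
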